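import Summits.CriticalPhenomena.PercolationContinuityZ3.Theorems.PercNearOneGluingNoHeavyLowerTailCovTauOfTA
import Summits.CriticalPhenomena.PercolationContinuityZ3.Theorems.PercNearOneGluingNoHeavyLowerTailCovTauStarBridge
import HarnessLib

/-!
# KN Question 8 at `|A| = 3`, centring side: the minimal model (UPZ₀'') of (UPZ) IS the marker dominance lemma MDL(X)

Support file (`--supports stmt-CriticalPhenomena-4575`, closed crux; independent mathematics on Kozma–Nitzan's Question 8 at
`|A| = 3`), prover `prim-hp-7` (gen 39).  No definitions, no named facts, no sorries; standard axioms.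

prim-ineq-gen-6's FINDING-G14.md §5(g) isolates, as "the MINIMAL OPEN MODEL of the centring side" of the PCOV ∧ PCOV-Z certificate,
  (UPZ₀'')  for every increasing `Φ` of `W = V(C_x)`, under `P_x = law(V(C_x) | x ↮ Y)`:
            `Cov_{P_x}(Φ, 1{u ∈ W}) ≥ c · Cov_{P_x}(Φ, 1{v ∈ W})`,   `c = P(u ↔ v | v ↮ x, v ↮ Y)`,
proves its `Y = ∅` case (TPC, `PocketCert.twoPoint_covComparison`, p223968) and reports the general case census-clean (0/310).
OBSERVATION (this file): the general case is LITERALLY prim-hp-7's functional marker dominance lemma with an avoided set,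
MDL(X) = `CovTau.markerDominanceAvoid` (gen 6, from `HullPort.taQ_nonneg_of_PvI`: the `T_A ≥ 0` induction with the one-edge
Bernstein identity + Gladkov's decision-tree Harris), under the dictionary `(s, X, y, z) := (x, Y, v, u)`:
  `μ(v ↮ x ∪ Y, v ↔ u) · cov_D(F(C_x), 1{x ↔ v}) ≤ μ(v ↮ x ∪ Y) · cov_D(F(C_x), 1{x ↔ u})`,  `D = {x ↮ Y}`,
  `cov_D(f, 1_A) := μ(D)·∫_{D∩A} f − (∫_D f)·μ(D ∩ A)` (`= μ(D)²·Cov_{P_x}`).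
* `PcovJ1.upzLeaf` — (UPZ₀'') for every finite avoided set `Y`, every `x ≠ v`, `u`, and every `F` monotone on VERTEX sets
  (no sign condition), in the vocabulary of `PocketCert.twoPoint_covComparison` (`F (openCluster ω x)`); one line from
  `CovTau.markerDominanceAvoid` through `CovTauStarN.liftΨ` (vertex-cluster functional as an edge-cluster functional).
Hence (UPZ₀), (UPZ₀'), (UPZ₀'') of FINDING-G14 §5(g2)–(g3) (unprimed constant) are theorems; what remains open there is the
observer-star dressing (UPZ')/(DOM)/(c5).
[cite: VandenbergHaggstromKahn2005, §2.1 (pp. 9–13), Thm. 1.4 (p. 7)] [cite: Gladkov2024, Thm. 3.2 (p. 4)]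
[cite: KozmaNitzan2024, Question 8 (§5.5 p. 36)]
-/

noncomputable section

namespace Summit.CriticalPhenomena.PercolationContinuityZ3.Theorems

namespace PcovJ1

open MeasureTheory Literature.Probability.Percolation Literature.Probability.LatticeModels
open CovTauStarN
open scoped Classical

variable {V : Type*} [Fintype V]

omit [Fintype V] in
/-- The vertex cluster functional as an edge-cluster functional: `liftΨ F x (C_x^{edge}(ω)) = F(C_x(ω))`. [folklore] -/
theorem liftΨ_openEdgeCluster (F : Set V → ℝ) (x : V) (ω : BondConfig V) :
    liftΨ F x (openEdgeCluster ω x) = F (openCluster ω x) := by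
  unfold liftΨ openCluster
  congr 1
  ext u
  simp only [Set.mem_union, Set.mem_singleton_iff, Set.mem_setOf_eq, reachable_iff_exists_mem_openEdgeCluster]

/-- **(UPZ₀'') = MDL(X)** (FINDING-G14 §5(g3), every avoided set `Y`): for `x ≠ v`, any `u`, any finite `Y` and every `F` monotone
on vertex sets, with `D = {x ↮ Y}`,
`μ({v ↮ x ∪ Y} ∩ {v ↔ u}) · (μ(D)·∫_{D∩{x↔v}} F(C_x) − (∫_D F(C_x))·μ(D∩{x↔v}))
   ≤ μ({v ↮ x ∪ Y}) · (μ(D)·∫_{D∩{x↔u}} F(C_x) − (∫_D F(C_x))·μ(D∩{x↔u}))`,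
i.e. `Cov(F(C_x), 1{u∈C_x} | x↮Y) ≥ P(u↔v | v↮x, v↮Y) · Cov(F(C_x), 1{v∈C_x} | x↮Y)`.
[cite: VandenbergHaggstromKahn2005, §2.1 (pp. 9–13)] [cite: Gladkov2024, Thm. 3.2 (p. 4)] [cite: KozmaNitzan2024, Question 8 (§5.5 p. 36)] -/
theorem upzLeaf (w : Sym2 V → unitInterval) (x u v : V) (Y : Set V) (hxv : x ≠ v) (F : Set V → ℝ)
    (hF : ∀ S T : Set V, S ⊆ T → F S ≤ F T) :
    (prodBernoulli w).real ({ω : BondConfig V | ∀ y ∈ insert x Y, ¬ (openGraph ω).Reachable v y} ∩ openConn v u) *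
        ((prodBernoulli w).real {ω : BondConfig V | ∀ y ∈ Y, ¬ (openGraph ω).Reachable x y} *
            (∫ ω in {ω : BondConfig V | ∀ y ∈ Y, ¬ (openGraph ω).Reachable x y} ∩ openConn x v,
              F (openCluster ω x) ∂(prodBernoulli w)) -
          (∫ ω in {ω : BondConfig V | ∀ y ∈ Y, ¬ (openGraph ω).Reachable x y},
              F (openCluster ω x) ∂(prodBernoulli w)) *
            (prodBernoulli w).real ({ω : BondConfig V | ∀ y ∈ Y, ¬ (openGraph ω).Reachable x y} ∩ openConn x v)) ≤
      (prodBernoulli w).real {ω : BondConfig V | ∀ y ∈ insert x Y, ¬ (openGraph ω).Reachable v y} *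
        ((prodBernoulli w).real {ω : BondConfig V | ∀ y ∈ Y, ¬ (openGraph ω).Reachable x y} *
            (∫ ω in {ω : BondConfig V | ∀ y ∈ Y, ¬ (openGraph ω).Reachable x y} ∩ openConn x u,
              F (openCluster ω x) ∂(prodBernoulli w)) -
          (∫ ω in {ω : BondConfig V | ∀ y ∈ Y, ¬ (openGraph ω).Reachable x y},
              F (openCluster ω x) ∂(prodBernoulli w)) *
            (prodBernoulli w).real ({ω : BondConfig V | ∀ y ∈ Y, ¬ (openGraph ω).Reachable x y} ∩ openConn x u)) := by
  have key := CovTau.markerDominanceAvoid w x v u Y hxv (liftΨ F x) (liftΨ_mono hF x)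
  simp only [liftΨ_openEdgeCluster] at key
  exact key

end PcovJ1

end Summit.CriticalPhenomena.PercolationContinuityZ3.Theorems

end
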